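import Mathlib

/-!
# Sketch — crux idea `killed-galerkin-pinch` for `StieltjesRepresentation` (stmt-AtomisticToContinuum-15248)

First lemmas of the line, stated over Mathlib only (they must elaborate; proofs are not required here).

* `DissipativeStieltjesOfPencil` — the PROVED abstract stub `StieltjesOfPencil` of line `cayley-pencil`
  with the energy identity (E) RELAXED to the dissipation inequality (E≤) `γ‖W γ f‖² ≤ ⟪f, W γ f⟫`
  (contraction instead of isometry; Sz.-Nagy dilation / Herglotz for contractions). Killing `ν > 0`
  destroys (E) but not (E≤), so this is the form the killed pencil needs.
* `KilledFiniteFoster` — its finite-dimensional matrix instance actually consumed by the Galerkin line: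
  for `S ⪰ 0`, `A` skew, `ν > 0` and `S g = g`, `γ ↦ gᵀ(ν + γS − A)⁻¹g` is `γ ×` a Stieltjes transform in `γ²`
  of mass `≤ ‖g‖²`, in the crux's layer-cake currency.
* `StieltjesClosed` — the cone of such functions with mass `≤ M` is closed under pointwise limits on `(0,∞)`
  (Helly selection + dominated convergence); used twice (`n → ∞` Galerkin, `ν ↓ 0` killing).
-/

open MeasureTheory Filter Set
open scoped Topology Matrix

namespace Summit.AtomisticToContinuum.FouriersLaw.Cruxes.StieltjesRepresentation.KilledGalerkinPinch

/-- The crux's representation currency: `F` is `γ ×` the Cauchy–Stieltjes transform in `γ²` of a finite positive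
measure on `[0,∞)` of mass `≤ M`, written through its distribution function `Φ` (layer cake). -/
def IsContactStieltjes (M : ℝ) (F : ℝ → ℝ) : Prop :=
  ∃ Φ : ℝ → ℝ, Monotone Φ ∧ (∀ s : ℝ, s ≤ 0 → Φ s = 0) ∧ (∀ s : ℝ, Φ s ≤ M) ∧
    ∀ γ : ℝ, 0 < γ → F γ = γ * ∫ t in Set.Ioi (0 : ℝ), Φ t * (2 * t / (γ ^ 2 + t ^ 2) ^ 2)

/-- FIRST LEMMA (abstract, dissipative form of the proved `StieltjesOfPencil`): a pseudo-resolvent family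
`W γ` on a real inner-product space satisfying the pencil identity (R) and the DISSIPATION INEQUALITY (E≤)
has Stieltjes diagonal matrix elements of mass `≤ ‖g‖²`. -/
def DissipativeStieltjesOfPencil : Prop :=
  ∀ (K : Type) [NormedAddCommGroup K] [InnerProductSpace ℝ K] (W : ℝ → K →L[ℝ] K),
    (∀ γ γ' : ℝ, 0 < γ → 0 < γ' → ∀ f : K, W γ f - W γ' f = (γ' - γ) • W γ (W γ' f)) →
    (∀ γ : ℝ, 0 < γ → ∀ f : K, γ * ‖W γ f‖ ^ 2 ≤ inner ℝ f (W γ f)) →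
    ∀ g : K, IsContactStieltjes (‖g‖ ^ 2) (fun γ => inner ℝ g (W γ g))

/-- FIRST LEMMA (finite-dimensional instance = "killed finite Foster"): `S` positive semidefinite, `A` skew,
killing `ν > 0`, observable in the unit eigenspace of `S` (Hermite level one: `S g = g`). Then
`γ ↦ gᵀ (ν·1 + γ S − A)⁻¹ g` is in the crux's Stieltjes class with mass `≤ ‖g‖²`.
(The matrix is invertible: its symmetric part is `ν + γS ⪰ ν > 0`.) -/
def KilledFiniteFoster : Prop :=
  ∀ (n : ℕ) (S A : Matrix (Fin n) (Fin n) ℝ) (ν : ℝ), 0 < ν → S.PosSemidef → Aᵀ = -A →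
    ∀ g : Fin n → ℝ, S.mulVec g = g →
      IsContactStieltjes (dotProduct g g)
        (fun γ => dotProduct g (((ν • (1 : Matrix (Fin n) (Fin n) ℝ) + γ • S - A)⁻¹).mulVec g))

/-- FIRST LEMMA (closure): pointwise limits on `(0,∞)` of functions in the Stieltjes class of mass `≤ M` stay in it
(Helly selection for the uniformly bounded monotone `Φ_k`, dominated convergence against `2t/(γ²+t²)²`). -/
def StieltjesClosed : Prop :=
  ∀ (M : ℝ) (F : ℕ → ℝ → ℝ) (G : ℝ → ℝ), (∀ k : ℕ, IsContactStieltjes M (F k)) →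
    (∀ γ : ℝ, 0 < γ → Tendsto (fun k : ℕ => F k γ) atTop (𝓝 (G γ))) → IsContactStieltjes M G

/-- The same closure along a real parameter `ν ↓ 0` (used for the killing limit). -/
def StieltjesClosedAlongKilling : Prop :=
  ∀ (M : ℝ) (F : ℝ → ℝ → ℝ) (G : ℝ → ℝ), (∀ ν : ℝ, 0 < ν → IsContactStieltjes M (F ν)) →
    (∀ γ : ℝ, 0 < γ → Tendsto (fun ν : ℝ => F ν γ) (𝓝[>] 0) (𝓝 (G γ))) → IsContactStieltjes M G

/-- THE PINCH (abstract finite-dimensional statement of the complementary variational principles that make the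
Galerkin values converge): on a finite-dimensional real inner product space, for `Ms` symmetric positive definite,
`A` skew and `M = Ms - A`, the resolvent element `⟪g, M⁻¹ g⟫` is the common value of the primal supremum
`sup_u 2⟪g,u⟫ − ⟪u, Ms u⟫ − ⟪A u, Ms⁻¹ A u⟫` and the dual infimum `inf_w ⟪g + A w, Ms⁻¹ (g + A w)⟫ + ⟪w, Ms w⟫`
(Fannjiang–Papanicolaou symmetrisation `H = Mᵀ Ms⁻¹ M = Ms + Aᵀ Ms⁻¹ A`). Stated for matrices. -/
def FinitePinch : Prop :=
  ∀ (n : ℕ) (Ms A : Matrix (Fin n) (Fin n) ℝ), Ms.PosDef → Aᵀ = -A → ∀ g : Fin n → ℝ,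
    let M : Matrix (Fin n) (Fin n) ℝ := Ms - A
    let primal : (Fin n → ℝ) → ℝ := fun u =>
      2 * dotProduct g u - dotProduct u (Ms.mulVec u) - dotProduct (A.mulVec u) (Ms⁻¹.mulVec (A.mulVec u))
    let dual : (Fin n → ℝ) → ℝ := fun w =>
      dotProduct (g + A.mulVec w) (Ms⁻¹.mulVec (g + A.mulVec w)) + dotProduct w (Ms.mulVec w)
    (∀ u, primal u ≤ dotProduct g (M⁻¹.mulVec g)) ∧ (∀ w, dotProduct g (M⁻¹.mulVec g) ≤ dual w) ∧
      (∃ u, primal u = dotProduct g (M⁻¹.mulVec g)) ∧ (∃ w, dual w = dotProduct g (M⁻¹.mulVec g))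

end Summit.AtomisticToContinuum.FouriersLaw.Cruxes.StieltjesRepresentation.KilledGalerkinPinch
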